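import Literature.Analysis.FluidPDE.NSLocalAnalyticityRadiusLocalisation
import Literature.Analysis.FluidPDE.WholeSpaceIBP
import Mathlib.Analysis.SpecialFunctions.SmoothTransition
import Mathlib.Analysis.InnerProductSpace.Calculus
import HarnessLib

/-!
# Bradshaw–Grujić–Kukavica local analyticity radius: the concrete `R = 12` cut-off

Analysis/FluidPDE definitions-layer file (namespace `Literature.Analysis.FluidPDE.BGK2015`) for
the proof of the named fact
`Literature.Analysis.FluidPDE.bradshawGrujicKukavica2015_local_analyticity_radius`
(Bradshaw–Grujić–Kukavica 2015, Thm. 2.3, §4: the localisation cut-off). The cut-off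
`cutoff12 x₁ = S((81 - ‖· - x₁‖²)/17)` (`S` the smooth transition) is an admissible `R = 12`
localisation cut-off (`isLocCutoff_cutoff12`: `≡ 1` on `B̄(x₁,8)`, supported in `B̄(x₁,9)`,
`0 ≤ χ ≤ 1`), a translate of the centred one, with **centre-independent bounds** for `∇χ` and
`Δχ` (`exists_cutoff12_bounds`).

## References

* Z. Bradshaw, Z. Grujić, I. Kukavica, J. Differential Equations 259 (2015), Thm. 2.3, §3–§4.
  [BradshawGrujicKukavica2015]
-/

noncomputable section

open MeasureTheory Set Function Filter Metric Real
open _root_.Topology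
open scoped ENNReal NNReal ContDiff Laplacian InnerProductSpace RealInnerProductSpace
open Literature.Analysis.FunctionSpaces.EuclideanSpace (complexify complexify_apply norm_complexify
  complexify_injective continuous_complexify)

namespace Literature.Analysis.FluidPDE

namespace BGK2015

/-! ### The concrete cut-off -/

/-- **The cut-off of the `R = 12` localisation**: `χ(x) = S((81 - ‖x - x₁‖²)/17)` — smooth,
`0 ≤ χ ≤ 1`, `χ = 1` on `B̄(x₁, 8)`, supported in `B̄(x₁, 9)`. [folklore] -/
def cutoff12 (x₁ x : EuclideanSpace ℝ (Fin 3)) : ℝ :=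
  Real.smoothTransition ((81 - ‖x - x₁‖ ^ 2) / 17)

/-- The cut-off is the translate of the centred one. [folklore] -/
theorem cutoff12_eq_comp (x₁ : EuclideanSpace ℝ (Fin 3)) : cutoff12 x₁ = fun x => cutoff12 0 (x - x₁) := by
  funext x; simp [cutoff12]

/-- The cut-off is smooth. [folklore] -/
theorem cutoff12_contDiff (x₁ : EuclideanSpace ℝ (Fin 3)) {n : ℕ∞} : ContDiff ℝ n (cutoff12 x₁) := by
  unfold cutoff12
  refine Real.smoothTransition.contDiff.comp ?_
  exact (contDiff_const.sub ((contDiff_norm_sq ℝ).comp (contDiff_id.sub contDiff_const))).div_const _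

/-- **The cut-off is an admissible `R = 12` localisation cut-off.** [folklore] -/
theorem isLocCutoff_cutoff12 (x₁ : EuclideanSpace ℝ (Fin 3)) : IsLocCutoff x₁ 12 (cutoff12 x₁) := by
  refine ⟨cutoff12_contDiff x₁, ?_, ?_, fun x => Real.smoothTransition.nonneg _, fun x => Real.smoothTransition.le_one _⟩
  · -- support in `B̄(x₁, 9)`
    norm_num
    refine closure_minimal (fun x hx => ?_) isClosed_closedBall
    rw [mem_closedBall, dist_eq_norm]
    by_contra h
    push Not at h
    refine hx (Real.smoothTransition.zero_of_nonpos ?_)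
    have : 81 < ‖x - x₁‖ ^ 2 := by nlinarith
    have : (81 - ‖x - x₁‖ ^ 2) / 17 < 0 := by
      apply div_neg_of_neg_of_pos <;> linarith
    exact this.le
  · -- `χ = 1` on `B̄(x₁, 8)`
    norm_num
    intro x hx
    rw [dist_eq_norm] at hx
    refine Real.smoothTransition.one_of_one_le ?_
    rw [le_div_iff₀ (by norm_num : (0 : ℝ) < 17)]
    nlinarith [norm_nonneg (x - x₁)]

/-- Translation commutes with the Laplacian (private copy). [folklore] -/
private theorem laplacian_comp_sub_apply (f : EuclideanSpace ℝ (Fin 3) → ℝ) (a x : EuclideanSpace ℝ (Fin 3)) :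
    (Δ (fun y => f (y - a))) x = (Δ f) (x - a) := by
  rw [InnerProductSpace.laplacian_eq_iteratedFDeriv_stdOrthonormalBasis,
    InnerProductSpace.laplacian_eq_iteratedFDeriv_stdOrthonormalBasis]
  simp only [sub_eq_add_neg, iteratedFDeriv_comp_add_right]

/-- **Centre-independent bounds for `∇χ` and `Δχ`.** [folklore] -/
theorem exists_cutoff12_bounds : ∃ L₁ L₂ : ℝ, 0 ≤ L₁ ∧ 0 ≤ L₂ ∧ ∀ x₁ y : EuclideanSpace ℝ (Fin 3),
    ‖gradient (cutoff12 x₁) y‖ ≤ L₁ ∧ |(Δ (cutoff12 x₁)) y| ≤ L₂ := by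
  set f := cutoff12 (0 : EuclideanSpace ℝ (Fin 3)) with hf
  have hfs : ContDiff ℝ ∞ f := cutoff12_contDiff 0
  have hsupp : HasCompactSupport f := by
    refine HasCompactSupport.of_support_subset_isCompact (isCompact_closedBall 0 9) ?_
    have h := (isLocCutoff_cutoff12 (0 : EuclideanSpace ℝ (Fin 3))).tsupport_subset
    norm_num at h
    exact (subset_tsupport _).trans h
  -- gradient bound of the centred cut-off
  have h1 : ContDiff ℝ 1 f := hfs.of_le (by norm_cast)
  obtain ⟨C₁, hC₁⟩ := (h1.continuous_fderiv one_ne_zero).bounded_above_of_compact_support (hsupp.fderiv ℝ)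
  -- Laplacian bound of the centred cut-off
  have hΔc : Continuous (Δ f) := by
    rw [InnerProductSpace.laplacian_eq_iteratedFDeriv_stdOrthonormalBasis]
    refine continuous_finsetSum _ fun i _ => ?_
    have h2 : Continuous fun x => iteratedFDeriv ℝ 2 f x := hfs.continuous_iteratedFDeriv (m := 2) (by norm_cast)
    exact (continuous_eval_const (![(stdOrthonormalBasis ℝ (EuclideanSpace ℝ (Fin 3))) i,
      (stdOrthonormalBasis ℝ (EuclideanSpace ℝ (Fin 3))) i] : Fin 2 → EuclideanSpace ℝ (Fin 3))).comp h2
  have hΔs : HasCompactSupport (Δ f) :=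
    hsupp.mono' fun x hx => by
      by_contra h
      exact hx (laplacian_eq_zero_of_notMem_tsupport h)
  obtain ⟨C₂, hC₂⟩ := hΔc.bounded_above_of_compact_support hΔs
  have hC₁0 : 0 ≤ C₁ := (norm_nonneg _).trans (hC₁ 0)
  have hC₂0 : 0 ≤ C₂ := (norm_nonneg _).trans (hC₂ 0)
  refine ⟨C₁, C₂, hC₁0, hC₂0, fun x₁ y => ⟨?_, ?_⟩⟩
  · rw [cutoff12_eq_comp x₁]
    have hcomp : fderiv ℝ (fun x => f (x - x₁)) y = fderiv ℝ f (y - x₁) := by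
      have h := ((h1.differentiable one_ne_zero (y - x₁)).hasFDerivAt.comp y
        ((hasFDerivAt_id y).sub_const x₁)).fderiv
      rw [ContinuousLinearMap.comp_id] at h
      exact h
    have hg : ‖gradient (fun x => f (x - x₁)) y‖ = ‖fderiv ℝ (fun x => f (x - x₁)) y‖ := by
      rw [gradient, LinearIsometryEquiv.norm_map]
    rw [hg, hcomp]
    exact hC₁ _
  · rw [cutoff12_eq_comp x₁, laplacian_comp_sub_apply]
    exact (Real.norm_eq_abs _).symm.le.trans (hC₂ _)

end BGK2015

end Literature.Analysis.FluidPDE
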